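import Summits.ResolutionOfSingularities.ResolutionOfSingularities.Theorems.EquisingularLiftEquisingularLiftNatValuationChartCentre
import Literature.AlgebraicGeometry.Resolution.BlowupStrictTransform
import HarnessLib

/-!
# [OURS · L1 W4.5(b) · EL♮] K-VAL-CENTRE-UNIQ (U-3a): the ambient centre prime lies over the strict-transform centre prime
# (`𝔓_v(A[I/b]) = comap (A[I/b] ↠ B[J/q b]) 𝔓_v(B[J/q b])`, ring level)
# (crux `EquisingularLiftNat` = stmt-ResolutionOfSingularities-20038; PARENT ≥ 4 band / kill test #50 K5-BMY, DSHARP-VOID §2 (2a))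

HONEST FRAMING. OURS (cell res-hironaka, crux chain w45b, slot W4.5(b)); NOT a statement of any manuscript; replaces the role of
NOTHING in the manuscript; AI-written, AI review is weaker than expert review. Helper `--supports stmt-ResolutionOfSingularities-20038
--as helper`. Piece (U-3a) (ring-level half of the residual (U-3) «ambient frame») of res-D-brk-4 g9's cut 2026-08-27T20:28:48Z of object
«(U) K-VAL-CENTRE-UNIQ» (res-L1-w45b-plan-1 RULING 20:06:38Z; LAST WORDS 20:30:30Z «exactly as you cut it»).

THE TWO FRAMES OF (2a). In `DSHARP-VOID.md` §2 (2a) the valuation `v` lives on the function field of the HYPERSURFACE `Y_j ⊂ P_j`; the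
ribbon centre `C_j` is blown up in the AMBIENT `P_j` (`π : P_{j+1} → P_j`) and `Y_{j+1} ↪ P_{j+1}` is the strict transform, itself the
blowing up `ρ : Y_{j+1} → Y_j` of `Y_j` along `C_j ∩ Y_j`. On stalk charts this is the SURJECTION of affine blow-up algebras
`A[I/b] ↠ B[J/q(b)]` along `q : A = 𝒪_{P,s} ↠ B = 𝒪_{Y,s}` (tree `BlowupStrictTransform.blowupAlgebraMap`, [GortzWedhorn2020, Prop.
13.96 (2)]). The (α)/(U) files produce TWO centre primes: `𝔓_A ⊂ A[I/b]` for the SUPPORTED valuation `v = v_B ∘ q` on `A` (p563432;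
its chart point in `P_{j+1}` is AMBIENT-BAD after a ribbon touch, p565158) and `𝔓_B ⊂ B[J/q(b)]` for `v_B` on `B` (its chart point in
`Y_{j+1}` is THE `v`-centre, unique by `IsBlowup.eq_of_stalkEmb_factors`, (U-2)). THIS FILE: **`𝔓_A` is the preimage of `𝔓_B`**
(`comap_blowupAlgebraMap_centre`), because the chart valuation of `A[1/b]` is the chart valuation of `B[1/q(b)]` pulled back along
`Localization.awayMap q b` (`apply_eq_apply_awayMap`, by the uniqueness `valuation_away_unique` of p563432). So at ring level the
ambient centre IS the strict-transform centre; the scheme-level sentence «`j(y′) = x′`» ((U-3b): the strict-transform closed immersion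
`j : Y_{j+1} → P_{j+1}` is `Spec` of `blowupAlgebraMap` on charts, tree `BlowupStrictTransform` §Scheme /
`IsBlowup.isClosedImmersion_of_comp_eq`) is the only residual of (2a) after this file.

References: U. Görtz, T. Wedhorn, *Algebraic Geometry I* (2020), Prop. 13.96 (2) [GortzWedhorn2020]; O. Zariski, P. Samuel,
*Commutative Algebra II*, Ch. VI §5 [ZariskiSamuel1960]; tree `…Resolution/BlowupStrictTransform.lean` (`blowupAlgebraMap`,
`coe_blowupAlgebraMap`, `awayMap_algebraMap`), `…NatValuationChartCentre` (p563432).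
-/

set_option linter.dupNamespace false -- mandated namespace `Summit.<Summit>.<Problem>` of this single-conjunct summit

noncomputable section

universe u v

open IsLocalRing IsLocalization
open Literature.AlgebraicGeometry.Resolution

namespace Summit.ResolutionOfSingularities.ResolutionOfSingularities.Cruxes.EquisingularLiftNat.Sections

namespace ValChartCentre

variable {A B : Type u} [CommRing A] [CommRing B] {Γ : Type v} [LinearOrderedCommGroupWithZero Γ]
  (q : A →+* B) (b : A) (vB : Valuation B Γ)
  {w : Valuation (Localization.Away b) Γ} (hw : ∀ a, w (algebraMap A (Localization.Away b) a) = vB (q a))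
  {wB : Valuation (Localization.Away (q b)) Γ} (hwB : ∀ y, wB (algebraMap B (Localization.Away (q b)) y) = vB y)
include hw hwB

/-- **The chart valuation of `A[1/b]` is the chart valuation of `B[1/q(b)]` pulled back along `A[1/b] → B[1/q(b)]`**, for the
valuation `v = v_B ∘ q` of `A` (support `⊇ ker q`) with `v_B (q b) ≠ 0`: both are extensions of `v` to `A[1/b]`, which are unique
(`valuation_away_unique`). [folklore] -/
theorem apply_eq_apply_awayMap (hb : vB (q b) ≠ 0) (y : Localization.Away b) :
    w y = wB (Localization.awayMap q b y) := by
  have hv : (vB.comap q) b ≠ 0 := by rwa [Valuation.comap_apply]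
  have h1 : ∀ a, w (algebraMap A (Localization.Away b) a) = (vB.comap q) a := fun a => by
    rw [Valuation.comap_apply, hw]
  have h2 : ∀ a, (wB.comap (Localization.awayMap q b)) (algebraMap A (Localization.Away b) a) = (vB.comap q) a :=
    fun a => by
    rw [Valuation.comap_apply, Valuation.comap_apply, awayMap_algebraMap, hwB]
  have := valuation_away_unique (vB.comap q) h1 hv (w' := wB.comap (Localization.awayMap q b)) h2 y
  rw [Valuation.comap_apply] at this
  exact this.symm

/-- **(U-3a) The ambient centre prime is the preimage of the strict-transform centre prime.** For `q : A → B`, ideals `I ⊆ A`,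
`J ⊆ B` with `q(I) ⊆ J`, `b ∈ A`, a valuation `v_B` of `B` with `v_B (q b) ≠ 0`, the chart valuations `w` (of `A[1/b]`, extending
`v = v_B ∘ q`) and `w_B` (of `B[1/q(b)]`, extending `v_B`), and the centres `𝔓_A = {w < 1} ⊆ A[I/b]`, `𝔓_B = {w_B < 1} ⊆ B[J/q(b)]`:
`𝔓_A = (A[I/b] → B[J/q(b)])⁻¹ 𝔓_B` for the tree's `blowupAlgebraMap` (GW 13.96 (2): on charts the strict-transform closed immersion).
[cite: GortzWedhorn2020, Prop. 13.96 (2)] -/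
theorem comap_blowupAlgebraMap_centre (I₀ : Ideal A) (J₀ : Ideal B) (hIJ : I₀.map q ≤ J₀) (hb : vB (q b) ≠ 0)
    {𝔓A : Ideal (blowupAlgebra I₀ b)} (h𝔓A : ∀ z : blowupAlgebra I₀ b, z ∈ 𝔓A ↔ w (z : Localization.Away b) < 1)
    {𝔓B : Ideal (blowupAlgebra J₀ (q b))}
    (h𝔓B : ∀ z : blowupAlgebra J₀ (q b), z ∈ 𝔓B ↔ wB (z : Localization.Away (q b)) < 1) :
    𝔓B.comap (blowupAlgebraMap q I₀ J₀ b hIJ) = 𝔓A := by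
  ext z
  rw [Ideal.mem_comap, h𝔓B, h𝔓A, coe_blowupAlgebraMap, apply_eq_apply_awayMap q b vB hw hwB hb]

/-- The same for the supports («strict-transform ideals»): `w z = 0 ↔ w_B (z ↦ B[J/q(b)]) = 0`. [folklore] -/
theorem apply_eq_zero_iff_apply_blowupAlgebraMap_eq_zero (I₀ : Ideal A) (J₀ : Ideal B) (hIJ : I₀.map q ≤ J₀)
    (hb : vB (q b) ≠ 0) (z : blowupAlgebra I₀ b) :
    w (z : Localization.Away b) = 0 ↔
      wB ((blowupAlgebraMap q I₀ J₀ b hIJ z : blowupAlgebra J₀ (q b)) : Localization.Away (q b)) = 0 := by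
  rw [coe_blowupAlgebraMap, apply_eq_apply_awayMap q b vB hw hwB hb]

end ValChartCentre

end Summit.ResolutionOfSingularities.ResolutionOfSingularities.Cruxes.EquisingularLiftNat.Sections
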